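import Summits.CriticalPhenomena.PercolationContinuityZ3.Theorems.PercNearOneGluingNoHeavyQuantRootReduction
import HarnessLib

/-!
# QUANT lane R8, T-DEC — the canonical mean-preserving re-pairing of a count law (I): weights, gates and the two MARGINAL
# identities (Lemma P of Theorem A, DEC-TAMP-G50 §1.1 (r4); the decomposition theorem itself is in part (II))

builds on p205010 (kernel theorem, internal audit signed; external expert review pending)

Support file (`--supports stmt-CriticalPhenomena-4575`), QUANT lane typer seat prim-quant-stmt (gen 18), rung R8 of
`run/shared/lean/prim/quant/LADDER.md`.  Asked for by prim-quant-census-2 g50 (`prim-quant-census-2-g50/DEC-TAMP-G50.md` §1.5,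
lane INBOX 07:12Z: "Lemma P via 'every law of mean T is a mixture of mean-T two-point laws'").  Theorems only (local notation
copied verbatim from `…QuantRootReduction`), no sorries, standard axioms.

SETTING.  A law `μ : ℕ → ℝ` on `{0, …, M}` (`μ ≥ 0`, `μ h = 0` for `h > M`, mass `1`), mean `T = Σ_h h·μ h`, upper deviation
`D = Σ_{h > T} (h − T)·μ h` (`= Σ_{h < T} (T − h)·μ h`, `dev_balance`).  THE CANONICAL RE-PAIRING: the pair `(lo, hi)` with
`lo < T < hi` gets weight `Λ lo hi = μ lo·μ hi·(hi − lo)/D` and gate `G lo hi = (T − lo)/(hi − lo)` (so the two-point law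
`TP[lo, hi, G]` has mean `T`); an atom AT the mean is the point mass `(h, h)` with weight `μ h`; all other pairs weigh `0`.
This file proves the MARGINALS: above the mean `Σ_{lo} Λ lo h·G lo h = μ h` (`= μ h·D/D`, `marginal_above`), below the mean
`Σ_{hi} Λ h hi·(1 − G h hi) = μ h` (`marginal_below`), hence the pointwise mixture identity
`Σ_{lo, hi ≤ B} Λ lo hi·TP[lo, hi, G lo hi](h) = μ h` for every `h` and every ambient bound `B ≥ M` (`mixture_pointwise`).  Part (II)
(`…QuantLawTwoPointDecomposition`, same seat) packages this as the hypothesis block of the root reduction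
(`Quant.RootDec.rtail_ge_of_terms` / `rtail_ge_of_heavyDec` / `rtail_ge_of_decCert`).

presearch: "a distribution with given mean is a convex combination of two-point distributions with the same mean" → classical
moment-space fact (corpus hybrid + vsearch: textbook pages on extreme points of moment sets, no explicit finitely-indexed formula in
our holdings; galaxy `two-point distributions|mean-preserving spread`: Rothschild–Stiglitz spreads) — the explicit product formula is
folklore, the kernel statement [this work].  The gluing rows served [cite: KozmaNitzan2024, Conjecture 3 (p. 15)]; product weights
[cite: Grimmett1999, §1.3 p. 10].
-/

namespace Summit.CriticalPhenomena.PercolationContinuityZ3.Theorems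

namespace Quant

namespace LawDec

open Finset

/-- the two-point law `{lo, hi; g}`: `hi` with probability `g`, `lo` with probability `1 − g` (verbatim from `…QuantRootReduction`) -/
local notation3 "TP[" lo ", " hi ", " g ", " h "]" =>
  (g : ℝ) * (if (h : ℕ) = (hi : ℕ) then (1 : ℝ) else 0) + (1 - (g : ℝ)) * (if (h : ℕ) = (lo : ℕ) then (1 : ℝ) else 0)

/-! ### 1. Deviations about the mean -/

/-- **Deviation balance**: for a law of total mass `1` and mean `T` on `{0..M}`, the upper deviation `Σ_{h > T} (h − T) μ h`
equals the lower deviation `Σ_{h < T} (T − h) μ h`. [this work] -/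
theorem dev_balance (M : ℕ) (μ : ℕ → ℝ) (T : ℝ) (hT : T = ∑ h ∈ Finset.range (M + 1), (h : ℝ) * μ h)
    (hμ1 : ∑ h ∈ Finset.range (M + 1), μ h = 1) :
    ∑ h ∈ Finset.range (M + 1), (if T < (h : ℝ) then ((h : ℝ) - T) * μ h else 0) =
      ∑ h ∈ Finset.range (M + 1), (if (h : ℝ) < T then (T - h) * μ h else 0) := by
  have h0 : ∑ h ∈ Finset.range (M + 1), ((h : ℝ) - T) * μ h = 0 := by
    have : ∑ h ∈ Finset.range (M + 1), ((h : ℝ) - T) * μ h =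
        ∑ h ∈ Finset.range (M + 1), (h : ℝ) * μ h - T * ∑ h ∈ Finset.range (M + 1), μ h := by
      rw [Finset.mul_sum, ← Finset.sum_sub_distrib]
      exact Finset.sum_congr rfl fun h _ => by ring
    rw [this, hμ1, ← hT, mul_one, sub_self]
  have hpt : ∀ h : ℕ, ((h : ℝ) - T) * μ h =
      (if T < (h : ℝ) then ((h : ℝ) - T) * μ h else 0) - (if (h : ℝ) < T then (T - h) * μ h else 0) := by
    intro h
    by_cases h1 : T < (h : ℝ)
    · rw [if_pos h1, if_neg (not_lt.2 h1.le), sub_zero]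
    · by_cases h2 : (h : ℝ) < T
      · rw [if_neg h1, if_pos h2, zero_sub]; ring
      · have : (h : ℝ) = T := le_antisymm (not_lt.1 h1) (not_lt.1 h2)
        rw [if_neg h1, if_neg h2, this, sub_self, zero_mul, sub_self]
  rw [Finset.sum_congr rfl fun h _ => hpt h, Finset.sum_sub_distrib] at h0
  linarith

/-- The upper deviation is nonnegative. [this work] -/
theorem dev_nonneg (M : ℕ) (μ : ℕ → ℝ) (T : ℝ) (hμ0 : ∀ h, 0 ≤ μ h) :
    0 ≤ ∑ h ∈ Finset.range (M + 1), (if T < (h : ℝ) then ((h : ℝ) - T) * μ h else 0) :=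
  Finset.sum_nonneg fun h _ => by
    split_ifs with h1
    · exact mul_nonneg (by linarith) (hμ0 h)
    · exact le_rfl

/-- An atom above the mean makes the upper deviation positive. [this work] -/
theorem dev_pos_of_above (M : ℕ) (μ : ℕ → ℝ) (T : ℝ) (hμ0 : ∀ h, 0 ≤ μ h) (h : ℕ) (hhM : h ≤ M)
    (hTh : T < (h : ℝ)) (hμh : 0 < μ h) :
    0 < ∑ h ∈ Finset.range (M + 1), (if T < (h : ℝ) then ((h : ℝ) - T) * μ h else 0) := by
  have hmem : h ∈ Finset.range (M + 1) := Finset.mem_range.2 (Nat.lt_succ_of_le hhM)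
  have hle := Finset.single_le_sum (f := fun h : ℕ => if T < (h : ℝ) then ((h : ℝ) - T) * μ h else 0)
    (fun i _ => by
      show 0 ≤ (if T < (i : ℝ) then ((i : ℝ) - T) * μ i else 0)
      split_ifs with h1
      · exact mul_nonneg (by linarith) (hμ0 i)
      · exact le_rfl) hmem
  have hpos : 0 < ((h : ℝ) - T) * μ h := mul_pos (by linarith) hμh
  simp only [if_pos hTh] at hle
  exact hpos.trans_le hle

/-- An atom below the mean makes the lower deviation positive. [this work] -/
theorem dev'_pos_of_below (M : ℕ) (μ : ℕ → ℝ) (T : ℝ) (hμ0 : ∀ h, 0 ≤ μ h) (h : ℕ) (hhM : h ≤ M)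
    (hhT : (h : ℝ) < T) (hμh : 0 < μ h) :
    0 < ∑ h ∈ Finset.range (M + 1), (if (h : ℝ) < T then (T - h) * μ h else 0) := by
  have hmem : h ∈ Finset.range (M + 1) := Finset.mem_range.2 (Nat.lt_succ_of_le hhM)
  have hle := Finset.single_le_sum (f := fun h : ℕ => if (h : ℝ) < T then (T - h) * μ h else 0)
    (fun i _ => by
      show 0 ≤ (if (i : ℝ) < T then (T - i) * μ i else 0)
      split_ifs with h1
      · exact mul_nonneg (by linarith) (hμ0 i)
      · exact le_rfl) hmem
  have hpos : 0 < (T - h) * μ h := mul_pos (by linarith) hμh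
  simp only [if_pos hhT] at hle
  exact hpos.trans_le hle

/-- Widening the range of a deviation-type sum does not change it (the law vanishes above `M`). [this work] -/
theorem sum_range_widen (M B : ℕ) (hMB : M ≤ B) (μ : ℕ → ℝ) (hμM : ∀ h, M < h → μ h = 0) (φ : ℕ → ℝ) :
    ∑ h ∈ Finset.range (B + 1), φ h * μ h = ∑ h ∈ Finset.range (M + 1), φ h * μ h := by
  symm
  refine Finset.sum_subset (Finset.range_subset_range.2 (by omega)) fun h hB hM => ?_
  rw [Finset.mem_range] at hB hM
  rw [hμM h (by omega), mul_zero]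

/-! ### 2. The canonical weights and gates, and the two marginals -/

/-- **Marginal ABOVE the mean.**  With `Λ lo hi = μ lo μ hi (hi − lo)/D` and `G lo hi = (T − lo)/(hi − lo)` on the pairs
`lo < T < hi` (point masses on the diagonal at `T`, zero elsewhere): for an index `h > T`,
`Σ_{lo ≤ B} Λ lo h · G lo h = μ h`. [this work] -/
theorem marginal_above (M B : ℕ) (hMB : M ≤ B) (μ : ℕ → ℝ) (hμ0 : ∀ h, 0 ≤ μ h) (hμM : ∀ h, M < h → μ h = 0)
    (hμ1 : ∑ h ∈ Finset.range (M + 1), μ h = 1) (T D : ℝ) (hT : T = ∑ h ∈ Finset.range (M + 1), (h : ℝ) * μ h)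
    (hD : D = ∑ h ∈ Finset.range (M + 1), (if T < (h : ℝ) then ((h : ℝ) - T) * μ h else 0))
    (Λ G : ℕ → ℕ → ℝ)
    (hΛ : ∀ lo hi, Λ lo hi = if ((lo : ℝ) < T ∧ T < (hi : ℝ)) then μ lo * μ hi * ((hi : ℝ) - lo) / D
      else if (lo = hi ∧ (lo : ℝ) = T) then μ lo else 0)
    (hG : ∀ lo hi, G lo hi = if ((lo : ℝ) < T ∧ T < (hi : ℝ)) then (T - lo) / ((hi : ℝ) - lo) else 0)
    (h : ℕ) (hTh : T < (h : ℝ)) :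
    ∑ lo ∈ Finset.range (B + 1), Λ lo h * G lo h = μ h := by
  -- pointwise form of the summand
  have hpt : ∀ lo : ℕ, Λ lo h * G lo h = μ h / D * (if (lo : ℝ) < T then (T - lo) * μ lo else 0) := by
    intro lo
    by_cases hlo : (lo : ℝ) < T
    · have hc : ((h : ℝ) - lo) ≠ 0 := by
        have : (lo : ℝ) < h := hlo.trans hTh
        linarith
      rw [hΛ, hG, if_pos ⟨hlo, hTh⟩, if_pos ⟨hlo, hTh⟩, if_pos hlo, div_mul_div_comm,
        show μ h / D * ((T - lo) * μ lo) = (μ h * ((T - lo) * μ lo)) / D by ring,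
        ← mul_div_mul_right (μ h * ((T - lo) * μ lo)) D hc]
      congr 1
      ring
    · have hG0 : G lo h = 0 := by rw [hG, if_neg (fun hh => hlo hh.1)]
      rw [hG0, mul_zero, if_neg hlo, mul_zero]
  rw [Finset.sum_congr rfl fun lo _ => hpt lo, ← Finset.mul_sum]
  -- the inner sum is the lower deviation, which equals `D`
  have hdev : ∑ lo ∈ Finset.range (B + 1), (if (lo : ℝ) < T then (T - lo) * μ lo else 0) = D := by
    have h1 : ∑ lo ∈ Finset.range (B + 1), (if (lo : ℝ) < T then (T - lo) * μ lo else 0) =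
        ∑ lo ∈ Finset.range (B + 1), (if (lo : ℝ) < T then (T - lo) else 0) * μ lo :=
      Finset.sum_congr rfl fun lo _ => by split_ifs <;> simp
    have h2 : ∑ lo ∈ Finset.range (M + 1), (if (lo : ℝ) < T then (T - lo) * μ lo else 0) =
        ∑ lo ∈ Finset.range (M + 1), (if (lo : ℝ) < T then (T - lo) else 0) * μ lo :=
      Finset.sum_congr rfl fun lo _ => by split_ifs <;> simp
    rw [h1, sum_range_widen M B hMB μ hμM, ← h2, ← dev_balance M μ T hT hμ1, ← hD]
  rw [hdev]
  by_cases hμh : μ h = 0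
  · rw [hμh, zero_div, zero_mul]
  · have hμh' : 0 < μ h := lt_of_le_of_ne (hμ0 h) (Ne.symm hμh)
    have hhM : h ≤ M := by
      by_contra hlt
      exact hμh (hμM h (not_le.1 hlt))
    have hDpos : 0 < D := by rw [hD]; exact dev_pos_of_above M μ T hμ0 h hhM hTh hμh'
    exact div_mul_cancel₀ (μ h) hDpos.ne'

/-- **Marginal BELOW the mean**: for an index `h < T`, `Σ_{hi ≤ B} Λ h hi · (1 − G h hi) = μ h`. [this work] -/
theorem marginal_below (M B : ℕ) (hMB : M ≤ B) (μ : ℕ → ℝ) (hμ0 : ∀ h, 0 ≤ μ h) (hμM : ∀ h, M < h → μ h = 0)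
    (hμ1 : ∑ h ∈ Finset.range (M + 1), μ h = 1) (T D : ℝ) (hT : T = ∑ h ∈ Finset.range (M + 1), (h : ℝ) * μ h)
    (hD : D = ∑ h ∈ Finset.range (M + 1), (if T < (h : ℝ) then ((h : ℝ) - T) * μ h else 0))
    (Λ G : ℕ → ℕ → ℝ)
    (hΛ : ∀ lo hi, Λ lo hi = if ((lo : ℝ) < T ∧ T < (hi : ℝ)) then μ lo * μ hi * ((hi : ℝ) - lo) / D
      else if (lo = hi ∧ (lo : ℝ) = T) then μ lo else 0)
    (hG : ∀ lo hi, G lo hi = if ((lo : ℝ) < T ∧ T < (hi : ℝ)) then (T - lo) / ((hi : ℝ) - lo) else 0)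
    (h : ℕ) (hhT : (h : ℝ) < T) :
    ∑ hi ∈ Finset.range (B + 1), Λ h hi * (1 - G h hi) = μ h := by
  have hpt : ∀ hi : ℕ, Λ h hi * (1 - G h hi) = μ h / D * (if T < (hi : ℝ) then ((hi : ℝ) - T) * μ hi else 0) := by
    intro hi
    by_cases hhi : T < (hi : ℝ)
    · have hc : ((hi : ℝ) - h) ≠ 0 := by
        have : (h : ℝ) < hi := hhT.trans hhi
        linarith
      have h1G : 1 - G h hi = ((hi : ℝ) - T) / ((hi : ℝ) - h) := by
        rw [hG, if_pos ⟨hhT, hhi⟩, eq_div_iff hc, sub_mul, div_mul_cancel₀ _ hc]; ring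
      rw [hΛ, if_pos ⟨hhT, hhi⟩, h1G, if_pos hhi, div_mul_div_comm,
        show μ h / D * (((hi : ℝ) - T) * μ hi) = (μ h * (((hi : ℝ) - T) * μ hi)) / D by ring,
        ← mul_div_mul_right (μ h * (((hi : ℝ) - T) * μ hi)) D hc]
      congr 1
      ring
    · have hΛ0 : Λ h hi = 0 := by
        rw [hΛ, if_neg (fun hh => hhi hh.2), if_neg (fun hh => absurd hh.2 (ne_of_lt hhT))]
      rw [hΛ0, zero_mul, if_neg hhi, mul_zero]
  rw [Finset.sum_congr rfl fun hi _ => hpt hi, ← Finset.mul_sum]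
  have hdev : ∑ hi ∈ Finset.range (B + 1), (if T < (hi : ℝ) then ((hi : ℝ) - T) * μ hi else 0) = D := by
    have h1 : ∑ hi ∈ Finset.range (B + 1), (if T < (hi : ℝ) then ((hi : ℝ) - T) * μ hi else 0) =
        ∑ hi ∈ Finset.range (B + 1), (if T < (hi : ℝ) then ((hi : ℝ) - T) else 0) * μ hi :=
      Finset.sum_congr rfl fun hi _ => by split_ifs <;> simp
    have h2 : ∑ hi ∈ Finset.range (M + 1), (if T < (hi : ℝ) then ((hi : ℝ) - T) * μ hi else 0) =
        ∑ hi ∈ Finset.range (M + 1), (if T < (hi : ℝ) then ((hi : ℝ) - T) else 0) * μ hi :=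
      Finset.sum_congr rfl fun hi _ => by split_ifs <;> simp
    rw [h1, sum_range_widen M B hMB μ hμM, ← h2, ← hD]
  rw [hdev]
  by_cases hμh : μ h = 0
  · rw [hμh, zero_div, zero_mul]
  · have hμh' : 0 < μ h := lt_of_le_of_ne (hμ0 h) (Ne.symm hμh)
    have hhM : h ≤ M := by
      by_contra hlt
      exact hμh (hμM h (not_le.1 hlt))
    have hDpos : 0 < D := by
      -- `D` equals the lower deviation, which the atom `h < T` makes positive
      rw [hD, dev_balance M μ T hT hμ1]
      exact dev'_pos_of_below M μ T hμ0 h hhM hhT hμh'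
    exact div_mul_cancel₀ (μ h) hDpos.ne'

/-- At an index that is neither below nor above the mean the off-diagonal pairs vanish: for `h` with `¬ T < h`,
`Σ_{lo ≤ B} Λ lo h · G lo h = 0`. [this work] -/
theorem offdiag_above_eq_zero (T : ℝ) (Λ G : ℕ → ℕ → ℝ)
    (hG : ∀ lo hi, G lo hi = if ((lo : ℝ) < T ∧ T < (hi : ℝ)) then (T - lo) / ((hi : ℝ) - lo) else 0)
    (B h : ℕ) (hTh : ¬ T < (h : ℝ)) :
    ∑ lo ∈ Finset.range (B + 1), Λ lo h * G lo h = 0 :=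
  Finset.sum_eq_zero fun lo _ => by rw [hG, if_neg (fun hh => hTh hh.2), mul_zero]

/-- For `h` with `¬ h < T`, `Σ_{hi ≤ B} Λ h hi · (1 − G h hi) = (μ h if h = T and h ≤ B, else 0)`: only the diagonal point mass
survives. [this work] -/
theorem offdiag_below_eq (μ : ℕ → ℝ) (T D : ℝ) (Λ G : ℕ → ℕ → ℝ)
    (hΛ : ∀ lo hi, Λ lo hi = if ((lo : ℝ) < T ∧ T < (hi : ℝ)) then μ lo * μ hi * ((hi : ℝ) - lo) / D
      else if (lo = hi ∧ (lo : ℝ) = T) then μ lo else 0)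
    (hG : ∀ lo hi, G lo hi = if ((lo : ℝ) < T ∧ T < (hi : ℝ)) then (T - lo) / ((hi : ℝ) - lo) else 0)
    (B h : ℕ) (hhT : ¬ (h : ℝ) < T) :
    ∑ hi ∈ Finset.range (B + 1), Λ h hi * (1 - G h hi) =
      if ((h : ℝ) = T ∧ h ∈ Finset.range (B + 1)) then μ h else 0 := by
  have hpt : ∀ hi : ℕ, Λ h hi * (1 - G h hi) = if h = hi then (if (h : ℝ) = T then μ h else 0) else 0 := by
    intro hi
    rw [hG, if_neg (fun hh => hhT hh.1), sub_zero, mul_one, hΛ, if_neg (fun hh => hhT hh.1)]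
    by_cases hhi : h = hi
    · rw [if_pos hhi]
      by_cases hT' : (h : ℝ) = T
      · rw [if_pos ⟨hhi, hT'⟩, if_pos hT']
      · rw [if_neg (fun hh => hT' hh.2), if_neg hT']
    · rw [if_neg (fun hh => hhi hh.1), if_neg hhi]
  rw [Finset.sum_congr rfl fun hi _ => hpt hi, Finset.sum_ite_eq]
  by_cases hmem : h ∈ Finset.range (B + 1)
  · rw [if_pos hmem]
    by_cases hT' : (h : ℝ) = T
    · rw [if_pos hT', if_pos ⟨hT', hmem⟩]
    · rw [if_neg hT', if_neg (fun hh => hT' hh.1)]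
  · rw [if_neg hmem, if_neg (fun hh => hmem hh.2)]

/-! ### 3. The mixture identity, pointwise -/

/-- **Expanding the two-point laws**: for `h ≤ B`,
`Σ_{lo ≤ B} Σ_{hi ≤ B} Λ lo hi · TP[lo, hi, G lo hi](h) = Σ_{lo ≤ B} Λ lo h · G lo h + Σ_{hi ≤ B} Λ h hi · (1 − G h hi)`. [this work] -/
theorem sum_pairs_TP_eq (Λ G : ℕ → ℕ → ℝ) (B h : ℕ) (hhB : h ∈ Finset.range (B + 1)) :
    ∑ lo ∈ Finset.range (B + 1), ∑ hi ∈ Finset.range (B + 1), Λ lo hi * TP[lo, hi, G lo hi, h] =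
      ∑ lo ∈ Finset.range (B + 1), Λ lo h * G lo h + ∑ hi ∈ Finset.range (B + 1), Λ h hi * (1 - G h hi) := by
  have hsplit : ∀ lo hi : ℕ, Λ lo hi * TP[lo, hi, G lo hi, h] =
      (if h = hi then Λ lo hi * G lo hi else 0) + (if h = lo then Λ lo hi * (1 - G lo hi) else 0) := by
    intro lo hi
    by_cases h1 : h = hi
    · by_cases h2 : h = lo
      · simp only [if_pos h1, if_pos h2]; ring
      · simp only [if_pos h1, if_neg h2]; ring
    · by_cases h2 : h = lo
      · simp only [if_neg h1, if_pos h2]; ring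
      · simp only [if_neg h1, if_neg h2]; ring
  simp_rw [hsplit, Finset.sum_add_distrib]
  congr 1
  · refine Finset.sum_congr rfl fun lo _ => ?_
    rw [Finset.sum_ite_eq, if_pos hhB]
  · rw [Finset.sum_comm]
    have : ∀ hi : ℕ, ∑ lo ∈ Finset.range (B + 1), (if h = lo then Λ lo hi * (1 - G lo hi) else 0) = Λ h hi * (1 - G h hi) :=
      fun hi => by rw [Finset.sum_ite_eq, if_pos hhB]
    exact Finset.sum_congr rfl fun hi _ => this hi

/-- **The mixture identity, pointwise**: for every `h : ℕ`, `Σ_{lo ≤ B} Σ_{hi ≤ B} Λ lo hi · TP[lo, hi, G lo hi](h) = μ h`. [this work] -/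
theorem mixture_pointwise (M B : ℕ) (hMB : M ≤ B) (μ : ℕ → ℝ) (hμ0 : ∀ h, 0 ≤ μ h) (hμM : ∀ h, M < h → μ h = 0)
    (hμ1 : ∑ h ∈ Finset.range (M + 1), μ h = 1) (T D : ℝ) (hT : T = ∑ h ∈ Finset.range (M + 1), (h : ℝ) * μ h)
    (hD : D = ∑ h ∈ Finset.range (M + 1), (if T < (h : ℝ) then ((h : ℝ) - T) * μ h else 0))
    (Λ G : ℕ → ℕ → ℝ)
    (hΛ : ∀ lo hi, Λ lo hi = if ((lo : ℝ) < T ∧ T < (hi : ℝ)) then μ lo * μ hi * ((hi : ℝ) - lo) / D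
      else if (lo = hi ∧ (lo : ℝ) = T) then μ lo else 0)
    (hG : ∀ lo hi, G lo hi = if ((lo : ℝ) < T ∧ T < (hi : ℝ)) then (T - lo) / ((hi : ℝ) - lo) else 0)
    (h : ℕ) :
    ∑ lo ∈ Finset.range (B + 1), ∑ hi ∈ Finset.range (B + 1), Λ lo hi * TP[lo, hi, G lo hi, h] = μ h := by
  by_cases hhB : h ∈ Finset.range (B + 1)
  · rw [sum_pairs_TP_eq Λ G B h hhB]
    by_cases hTh : T < (h : ℝ)
    · -- above the mean
      rw [marginal_above M B hMB μ hμ0 hμM hμ1 T D hT hD Λ G hΛ hG h hTh,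
        offdiag_below_eq μ T D Λ G hΛ hG B h (not_lt.2 hTh.le), if_neg (fun hh => absurd hh.1 (ne_of_gt hTh)), add_zero]
    · by_cases hhT : (h : ℝ) < T
      · -- below the mean
        rw [marginal_below M B hMB μ hμ0 hμM hμ1 T D hT hD Λ G hΛ hG h hhT,
          offdiag_above_eq_zero T Λ G hG B h hTh, zero_add]
      · -- at the mean: the point mass
        have hEq : (h : ℝ) = T := le_antisymm (not_lt.1 hTh) (not_lt.1 hhT)
        rw [offdiag_above_eq_zero T Λ G hG B h hTh, offdiag_below_eq μ T D Λ G hΛ hG B h hhT,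
          if_pos ⟨hEq, hhB⟩, zero_add]
  · -- beyond the ambient bound: both sides vanish
    have hB : B < h := by rw [Finset.mem_range] at hhB; omega
    rw [hμM h (lt_of_le_of_lt hMB hB)]
    refine Finset.sum_eq_zero fun lo hlo => Finset.sum_eq_zero fun hi hhi => ?_
    rw [Finset.mem_range] at hlo hhi
    rw [if_neg (show ¬ h = hi by omega), if_neg (show ¬ h = lo by omega), mul_zero, mul_zero, add_zero, mul_zero]

/-- Total mass of a two-point law with atoms `≤ B`: `Σ_{h ≤ B} TP[lo, hi, g](h) = 1`. [this work] -/
theorem sum_TP_eq_one (lo hi : ℕ) (g : ℝ) (B : ℕ) (hlo : lo ≤ B) (hhi : hi ≤ B) :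
    ∑ h ∈ Finset.range (B + 1), TP[lo, hi, g, h] = 1 := by
  rw [Finset.sum_add_distrib, ← Finset.mul_sum, ← Finset.mul_sum, Finset.sum_ite_eq', Finset.sum_ite_eq',
    if_pos (Finset.mem_range.2 (Nat.lt_succ_of_le hhi)), if_pos (Finset.mem_range.2 (Nat.lt_succ_of_le hlo))]
  ring

/-- Sums over `Fin (B+1) × Fin (B+1)` are double sums over `range (B+1)`. [this work] -/
theorem sum_finPairs_eq (B : ℕ) (F : ℕ → ℕ → ℝ) :
    ∑ r : Fin (B + 1) × Fin (B + 1), F (r.1 : ℕ) (r.2 : ℕ) =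
      ∑ lo ∈ Finset.range (B + 1), ∑ hi ∈ Finset.range (B + 1), F lo hi := by
  rw [Fintype.sum_prod_type]
  have hinner : ∀ a : Fin (B + 1), ∑ b : Fin (B + 1), F (a : ℕ) (b : ℕ) = ∑ hi ∈ Finset.range (B + 1), F (a : ℕ) hi :=
    fun a => Fin.sum_univ_eq_sum_range (F (a : ℕ)) (B + 1)
  rw [Finset.sum_congr rfl fun a _ => hinner a]
  exact Fin.sum_univ_eq_sum_range (fun lo => ∑ hi ∈ Finset.range (B + 1), F lo hi) (B + 1)

/-! ### 4. Genuine pairs -/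

/-- **What a genuine pair looks like**: if `Λ lo hi > 0` then either `lo < T < hi` with both atoms charged and `D > 0`, or
`lo = hi` is an atom at the mean. [this work] -/
theorem genuine_cases (μ : ℕ → ℝ) (hμ0 : ∀ h, 0 ≤ μ h) (T D : ℝ) (hD0 : 0 ≤ D) (Λ : ℕ → ℕ → ℝ)
    (hΛ : ∀ lo hi, Λ lo hi = if ((lo : ℝ) < T ∧ T < (hi : ℝ)) then μ lo * μ hi * ((hi : ℝ) - lo) / D
      else if (lo = hi ∧ (lo : ℝ) = T) then μ lo else 0)
    (lo hi : ℕ) (hpos : 0 < Λ lo hi) :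
    ((lo : ℝ) < T ∧ T < (hi : ℝ) ∧ 0 < μ lo ∧ 0 < μ hi ∧ 0 < D) ∨ (lo = hi ∧ (lo : ℝ) = T ∧ 0 < μ lo) := by
  rw [hΛ] at hpos
  by_cases h1 : (lo : ℝ) < T ∧ T < (hi : ℝ)
  · rw [if_pos h1] at hpos
    left
    refine ⟨h1.1, h1.2, ?_, ?_, ?_⟩
    · by_contra hle
      have : μ lo = 0 := le_antisymm (not_lt.1 hle) (hμ0 lo)
      rw [this, zero_mul, zero_mul, zero_div] at hpos
      exact lt_irrefl _ hpos
    · by_contra hle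
      have : μ hi = 0 := le_antisymm (not_lt.1 hle) (hμ0 hi)
      rw [this, mul_zero, zero_mul, zero_div] at hpos
      exact lt_irrefl _ hpos
    · by_contra hle
      have : D = 0 := le_antisymm (not_lt.1 hle) hD0
      rw [this, div_zero] at hpos
      exact lt_irrefl _ hpos
  · rw [if_neg h1] at hpos
    by_cases h2 : lo = hi ∧ (lo : ℝ) = T
    · rw [if_pos h2] at hpos
      exact Or.inr ⟨h2.1, h2.2, hpos⟩
    · rw [if_neg h2] at hpos
      exact absurd hpos (lt_irrefl _)

end LawDec

end Quant

end Summit.CriticalPhenomena.PercolationContinuityZ3.Theorems
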